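import Summits.CriticalPhenomena.CardyFormulaZ2.Theorems.CardyFlipRussoCoveringLegRobustDefs
import Literature.Probability.Percolation.SitePaths
import Literature.Probability.Percolation.BoxCrossingProofs
import Literature.Probability.Percolation.TriCrossingSandwich
import Literature.Probability.RandomPlanarGeometry.PlanarDomainsTopology
import HarnessLib

/-!
# Stub `stub_lowerInclusion` of line `five-arm-null` (skeleton v5), crux `CardyFlipRusso.CoveringLeg`

Helper file `--supports stmt-CriticalPhenomena-6435` proving the registered stub
`Sig.stub_lowerInclusion` of `CardyFlipRussoCoveringLegRobustDefs.lean`: the corner-free LOWER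
inclusion of the Bollobás–Riordan collar sandwich for the CRUDE crossing event `crossS` of site
percolation on Beffara's centred square lattice `G_s` (frame B, drawing `zS`).

THE STATEMENT.  `R = (Ω; arcs 0–3)` is a conformal rectangle and `Q` a comparison quad in lower
sandwich position with room `r`, lateral margin `m` and plate margin `t`: points of the
`r`-fattening `Q_r` of `Q` off `Ω` are `t`-close to `arc 0` or to `arc 2` (h3), points of `Q_r` in
`Ω` are `m`-far from `arc 1` and `arc 3` (h4), the `r`-fattened end arcs `Q.arc 0`, `Q.arc 2` lie
off `Ω`, `t`-close to `arc 0`, resp. `arc 2` (h5, h6), and `arc 0`, `arc 2` are `3t`-separated.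
Then for `0 < δ`, `3δ ≤ r`, `δ < m`, `δ ≤ t` and every translation `‖a‖ ≤ δ`, the crude crossing
event of `Q + a` at mesh `δ` is contained in that of `R`.

THE PROOF (Bollobás–Riordan 2006, Ch. 7, Claim 19 first part and remark p. 195; pure metric
bookkeeping plus path surgery).  Edges of `G_s` have length `≤ δ` at mesh `δ` (`lower_dist_le`).
A site `y` of an open path of the event of `Q + a` has `δ·zS y ∈ Q + a ⊆ Q_r`, so off `Ω` it is
"side 0" (`t`-close to `arc 0`) or "side 2", never both, and a side-0 site is not adjacent to a
side-2 site (`lower_sep`: two arc points at distance `≤ 2t + δ ≤ 3t`).  The start is side 0 and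
the end side 2 (h5, h6 after undoing the translation, `lower_mem_cthickening_arc`).  After the
LAST side-0 site `a₀` the next site `b` is in `Ω` and the segment `[δ zS b, δ zS a₀]` meets
`∂Ω = ⋃ arcs` (`frontier_subset_arcs_zero_two`) at a point within `δ` of both ends, which cannot
lie on `arc 1 ∪ arc 3` (margin `m > δ`) nor on `arc 2` (separation), so `δ·zS b` is within `δ` of
`arc 0` (`lower_entry`); the
path then stays in `Ω` until it FIRST leaves `Ω`, necessarily to a side-2 site, and the last
inside site is within `δ` of `arc 2` by the symmetric argument.  The piece in between is an open
path of the event `crossS R δ` (`PathIn.last_exit`, `PathIn.exit`, `PathIn.mem_siteConnIn`).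

References: B. Bollobás, O. Riordan, *Percolation*, CUP (2006), Ch. 7 Claim 19 p. 192 and remark
p. 195 [BollobasRiordan2006]; V. Beffara, *Is critical 2D percolation universal?*, Progr. Probab.
60 (2008) §5.1 [Beffara2008Universal].
-/

noncomputable section

namespace Summit.CriticalPhenomena.CardyFormulaZ2.Cruxes.CoveringLeg.FiveArmNull

open Set Metric
open Literature.Probability.RandomPlanarGeometry Literature.Probability.Percolation
open Literature.Barriers.CriticalPhenomena (MixedSite)

/-! ### Metric bookkeeping -/

/-- **Edges of `G_s` have length `≤ δ` at mesh `δ`** in the frame `zS` (`ℤ²`-edges: `δ`;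
centre–corner edges: `δ/√2`). [cite: Beffara2008Universal, §5.1] -/
theorem lower_dist_le {δ : ℝ} (hδ : 0 < δ) {y y' : MixedSite} (h : gsGraph.Adj y y') :
    dist ((δ : ℂ) * zS y) ((δ : ℂ) * zS y') ≤ δ := by
  rw [gsGraph_eq] at h
  have h1 : dist (zS y) (zS y') ≤ 1 := cover_dist_coverZ_le_one h
  rw [dist_eq_norm, ← mul_sub, norm_mul, Complex.norm_real, Real.norm_of_nonneg hδ.le,
    ← dist_eq_norm]
  calc δ * dist (zS y) (zS y') ≤ δ * 1 := by gcongr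
    _ = δ := mul_one δ

/-- A point of the translated domain `Q + a`, `‖a‖ ≤ δ ≤ r`, lies in the `r`-fattening of `Q`.
[folklore] -/
theorem lower_mem_cthickening_carrier (Q : ConformalRectangle) {a p : ℂ} {δ r : ℝ} (ha : ‖a‖ ≤ δ)
    (hr : δ ≤ r) (h : p ∈ (Q.map (similarity 1 one_ne_zero a)).carrier) :
    p ∈ cthickening r Q.carrier := by
  rw [MarkedDomain.carrier_map] at h
  obtain ⟨z, hz, rfl⟩ := h
  refine mem_cthickening_of_dist_le _ z r _ hz ?_
  rw [similarity_apply, one_mul, dist_eq_norm, add_sub_cancel_left]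
  exact ha.trans hr

/-- A point `2δ`-close to the translated arc `Q.arc i + a`, `‖a‖ ≤ δ`, `3δ ≤ r`, lies in the
`r`-fattening of `Q.arc i`. [folklore] -/
theorem lower_mem_cthickening_arc (Q : ConformalRectangle) (i : Fin 4) {a p : ℂ} {δ r : ℝ}
    (ha : ‖a‖ ≤ δ) (hr : 3 * δ ≤ r)
    (h : infDist p ((Q.map (similarity 1 one_ne_zero a)).arc i) ≤ 2 * δ) :
    p ∈ cthickening r (Q.arc i) := by
  obtain ⟨q, hq, hpq⟩ := ((Q.map (similarity 1 one_ne_zero a)).isCompact_arc i).exists_infDist_eq_dist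
    ⟨_, (Q.map (similarity 1 one_ne_zero a)).pt_mem_arc_self i⟩ p
  rw [hpq] at h
  rw [MarkedDomain.arc_map] at hq
  obtain ⟨z, hz, rfl⟩ := hq
  rw [similarity_apply, one_mul] at h
  refine mem_cthickening_of_dist_le p z r _ hz ?_
  calc dist p z ≤ dist p (z + a) + dist (z + a) z := dist_triangle _ _ _
    _ ≤ 2 * δ + δ := by
        gcongr
        rw [dist_eq_norm, add_sub_cancel_left]
        exact ha
    _ ≤ r := by linarith

/-- **Separation**: two points at distance `≤ δ ≤ t` cannot be `t`-close to two compact sets at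
distance `> 3t` from each other (nearest points and the triangle inequality). [folklore] -/
theorem lower_sep {A B : Set ℂ} (hAc : IsCompact A) (hBc : IsCompact B) (hAn : A.Nonempty)
    (hBn : B.Nonempty) {t δ : ℝ} (hAB : ∀ a ∈ A, ∀ b ∈ B, 3 * t < dist a b) (hδt : δ ≤ t)
    {z z' : ℂ} (hzz' : dist z z' ≤ δ) (hzA : infDist z A ≤ t) (hz'B : infDist z' B ≤ t) :
    False := by
  obtain ⟨a, ha, hza⟩ := hAc.exists_infDist_eq_dist hAn z
  obtain ⟨b, hb, hz'b⟩ := hBc.exists_infDist_eq_dist hBn z'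
  linarith [hAB a ha b hb, dist_triangle4 a z z' b, dist_comm a z]

/-- **Entering `Ω` across the near arc** (Bollobás–Riordan's remark p. 195 for the crude event):
let `frontier Ω ⊆ (A ∪ B) ∪ (C ∪ E)` with `A`, `B` compact and `3t`-separated.  If `p ∉ Ω` is
`t`-close to `A`, `q ∈ Ω` is `m`-far from `C` and `E`, and `dist p q ≤ δ` with `δ ≤ t`, `δ < m`,
then `q` is `δ`-close to `A`: the segment `[q, p]` meets `∂Ω` at a point within `δ` of both ends,
which is off `C ∪ E` (margin) and off `B` (separation), hence on `A`.
[cite: BollobasRiordan2006, Ch. 7 Claim 19 p. 192 and remark p. 195] -/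
theorem lower_entry {Ω A B C E : Set ℂ} (hΩ : IsOpen Ω) (hfr : frontier Ω ⊆ (A ∪ B) ∪ (C ∪ E))
    (hAc : IsCompact A) (hBc : IsCompact B) (hAn : A.Nonempty) (hBn : B.Nonempty) {m t δ : ℝ}
    (hAB : ∀ a ∈ A, ∀ b ∈ B, 3 * t < dist a b) (hδt : δ ≤ t) (hδm : δ < m) {p q : ℂ}
    (hpq : dist p q ≤ δ) (hp : p ∉ Ω) (hpA : infDist p A ≤ t) (hq : q ∈ Ω)
    (hqC : m ≤ infDist q C) (hqE : m ≤ infDist q E) : infDist q A ≤ δ := by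
  have hseg : ¬ segment ℝ q p ⊆ Ω := fun h => hp (h (right_mem_segment ℝ q p))
  obtain ⟨w, hw, hwfr⟩ := exists_mem_segment_frontier hΩ hq hseg
  have hsum := dist_add_dist_of_mem_segment hw
  have hqw : dist q w ≤ δ := by
    linarith [dist_nonneg (x := w) (y := p), dist_comm p q]
  have hpw : dist p w ≤ δ := by
    linarith [dist_nonneg (x := q) (y := w), dist_comm p q, dist_comm p w]
  rcases hfr hwfr with (hwA | hwB) | (hwC | hwE)
  · exact (infDist_le_dist_of_mem hwA).trans hqw
  · exact (lower_sep hAc hBc hAn hBn hAB hδt hpw hpA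
      ((infDist_zero_of_mem hwB).le.trans (infDist_nonneg.trans hpA))).elim
  · exact absurd (hqC.trans ((infDist_le_dist_of_mem hwC).trans hqw)) (not_le.2 hδm)
  · exact absurd (hqE.trans ((infDist_le_dist_of_mem hwE).trans hqw)) (not_le.2 hδm)

/-! ### The lower inclusion -/

/-- **Lower inclusion** (the corner-free half of Bollobás–Riordan's Claim 19, for the CRUDE
crossing event of site percolation on `G_s`): if the lower quad `Q` of `R` is in sandwich position
with margins `m, t` and room `r`, the arcs `0`, `2` of `R` are `3t`-separated, and `0 < δ`,
`3δ ≤ r`, `δ < m`, `δ ≤ t`, then for every translation `a` with `‖a‖ ≤ δ` the crude frame-B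
crossing event of `Q + a` at mesh `δ` is contained in that of `R`.
[cite: BollobasRiordan2006, Ch. 7 Claim 19 p. 192 and remark p. 195] -/
theorem stub_lowerInclusion :
    Summit.CriticalPhenomena.CardyFormulaZ2.Cruxes.CoveringLeg.FiveArmNull.Sig.stub_lowerInclusion := by
  intro R Q m t r _hm _ht _hr h3 h4 h5 h6 hsep δ hδ hδr hδm hδt a ha
  rintro ω ⟨u, v, hu, hv, hω⟩
  -- geometry of `R`
  have hfr := frontier_subset_arcs_zero_two R
  have hfr' : frontier R.carrier ⊆ (R.arc 2 ∪ R.arc 0) ∪ (R.arc 1 ∪ R.arc 3) := by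
    rwa [union_comm (R.arc 2)]
  have hsep' : ∀ x ∈ R.arc 2, ∀ y ∈ R.arc 0, 3 * t < dist x y := fun x hx y hy => by
    rw [dist_comm]; exact hsep y hy x hx
  have hc0 := R.isCompact_arc 0
  have hc2 := R.isCompact_arc 2
  have hn0 : (R.arc 0).Nonempty := ⟨_, R.pt_mem_arc_self 0⟩
  have hn2 : (R.arc 2).Nonempty := ⟨_, R.pt_mem_arc_self 2⟩
  have hδr' : δ ≤ r := by linarith
  -- (F1) sites of the window of `Q + a` are drawn in the `r`-fattening of `Q`
  have hthick : ∀ y : MixedSite, (δ : ℂ) * zS y ∈ (Q.map (similarity 1 one_ne_zero a)).carrier →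
      (δ : ℂ) * zS y ∈ cthickening r Q.carrier :=
    fun y hy => lower_mem_cthickening_carrier Q ha hδr' hy
  -- (F3) the endpoints: `u` is off `Ω` on side 0, `v` is off `Ω` on side 2
  obtain ⟨huΩ, hu0⟩ := h5 _ (lower_mem_cthickening_arc Q 0 ha hδr hu)
  obtain ⟨hvΩ, hv2⟩ := h6 _ (lower_mem_cthickening_arc Q 2 ha hδr hv)
  -- (F5) the open path and its last side-0 site
  have hp : PathIn gsGraph ({y | (δ : ℂ) * zS y ∈ (Q.map (similarity 1 one_ne_zero a)).carrier} ∩ ω)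
      u v := PathIn.of_mem_siteConnIn hω
  have hvC : v ∉ {y : MixedSite | (δ : ℂ) * zS y ∉ R.carrier ∧
      infDist ((δ : ℂ) * zS y) (R.arc 0) ≤ t} := fun h =>
    lower_sep hc0 hc2 hn0 hn2 hsep hδt (by rw [dist_self]; exact hδ.le) h.2 hv2
  obtain ⟨a₀, b, ha₀C, -, hbC, hab, hpb⟩ :=
    hp.last_exit (C := {y : MixedSite | (δ : ℂ) * zS y ∉ R.carrier ∧
      infDist ((δ : ℂ) * zS y) (R.arc 0) ≤ t}) ⟨huΩ, hu0⟩ hvC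
  have hbA := hpb.left_mem
  have hdab : dist ((δ : ℂ) * zS a₀) ((δ : ℂ) * zS b) ≤ δ := lower_dist_le hδ hab
  -- the site `b` after the last side-0 site is inside `Ω` …
  have hbΩ : (δ : ℂ) * zS b ∈ R.carrier := by
    by_contra hbΩ
    rcases h3 _ (hthick b hbA.1.1) hbΩ with h0 | h2
    · exact hbC ⟨hbΩ, h0⟩
    · exact lower_sep hc0 hc2 hn0 hn2 hsep hδt hdab ha₀C.2 h2
  -- … and within `δ` of `arc 0`
  obtain ⟨hb1, hb3⟩ := h4 _ (hthick b hbA.1.1) hbΩ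
  have hb0 : infDist ((δ : ℂ) * zS b) (R.arc 0) ≤ δ :=
    lower_entry R.isOpen hfr hc0 hc2 hn0 hn2 hsep hδt hδm hdab ha₀C.1 ha₀C.2 hbΩ hb1 hb3
  -- the first exit from `Ω` after `b`: across `arc 2`
  obtain ⟨a', b', ha'R, hb'R, hb'A, hab', hpa'⟩ :=
    hpb.exit (R := {y : MixedSite | (δ : ℂ) * zS y ∈ R.carrier}) hbΩ hvΩ
  have hda'b' : dist ((δ : ℂ) * zS b') ((δ : ℂ) * zS a') ≤ δ := by
    rw [dist_comm]; exact lower_dist_le hδ hab'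
  have hb'2 : infDist ((δ : ℂ) * zS b') (R.arc 2) ≤ t := by
    rcases h3 _ (hthick b' hb'A.1.1) hb'R with h0 | h2
    · exact absurd ⟨hb'R, h0⟩ hb'A.2
    · exact h2
  have ha'A := hpa'.right_mem
  obtain ⟨ha'1, ha'3⟩ := h4 _ (hthick a' ha'A.2.1.1) ha'R
  have ha'2 : infDist ((δ : ℂ) * zS a') (R.arc 2) ≤ δ :=
    lower_entry R.isOpen hfr' hc2 hc0 hn2 hn0 hsep' hδt hδm hda'b' hb'R hb'2 ha'R ha'1 ha'3
  -- the piece from `b` to `a'` is an open crude crossing of `R`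
  refine ⟨b, a', hb0.trans (by linarith), ha'2.trans (by linarith), ?_⟩
  exact (hpa'.mono (A' := {y : MixedSite | (δ : ℂ) * zS y ∈ R.carrier} ∩ ω)
    fun y hy => ⟨hy.1, hy.2.1.2⟩).mem_siteConnIn

end Summit.CriticalPhenomena.CardyFormulaZ2.Cruxes.CoveringLeg.FiveArmNull

end
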